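import Mathlib.LinearAlgebra.Matrix.SchurComplement
import Mathlib.LinearAlgebra.Matrix.RowCol
import Mathlib.LinearAlgebra.Matrix.Rank
import Literature.Computability.AlgebraicComplexity.SymmetricDetRepresentationProofs
import Literature.Computability.AlgebraicComplexity.RankOneDeterminantalExpressionsDetProofs
import Literature.Computability.AlgebraicComplexity.LR17EquivariantRepresentations
import HarnessLib

/-!
# `rdc(det_n) ≤ 2n³ + 3`: a regular determinantal expression of the determinant from a branching
# program (Ikenmeyer–Landsberg 2017, Prop. 3.1; weak form of their Prop. 2.3 = LR17 Question 2.18)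

Topic `Literature/Computability/AlgebraicComplexity` (cell val-lit, typer t12; companion of
`LR17EquivariantRepresentations.lean`, where `rdc = regularDetComplexity` and the named fact
`ikenmeyerLandsberg2017_prop_2_3` — `rdc(det_m) ≤ (m³ - m)/3 + 1` — live).

Sources. C. Ikenmeyer, J. M. Landsberg, *On the complexity of the permanent in various computational
models*, J. Pure Appl. Algebra 221 (2017), arXiv:1610.00159 [IkenmeyerLandsberg2017], held text
`paper:arxiv-1610.00159`: **Prop. 3.1** (p0006:L5–L8) "`dc(P) ≤ labpc(P) - 1`. Moreover, if the constant
term of `P` is zero, then we also have `rdc(P) ≤ labpc(P) - 1`", proof p0006:L10–L33 (identify source and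
sink of a layered algebraic branching program, put loops of weight `1` at the other vertices; the
adjacency matrix `A` has `det A = ±P`, its constant part is unitriangular up to the root, hence of corank
`1` when `P(0) = 0`); **Prop. 2.3** (p0004:L66) `rdc(det_m) ≤ (m³ - m)/3 + 1` via the Mahajan–Vinay
program (Prop. 3.2). J. M. Landsberg, N. Ressayre 2017, Question 2.18 (arXiv:1508.05788 p0007:L104–L109:
"What is the growth of `rdc(det_m)`?"). [LandsbergRessayre2017]

What is PROVED here (no named facts, no definitions):
* `GKKP2011.det_fromBlocks_abp` — IL17 Prop. 3.1 as a matrix identity, for a branching program given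
  (as in `SymmetricDetRepresentationProofs.lean`) by an internal adjacency matrix `N` with
  `(1 + N) G = 1`, `det (1 + N) = 1`, source weights `a`, sink weights `b`: the matrix
  `[[0, -aᵀ], [b, 1 + N]]` (root = merged source/sink, loops = the `1`) has determinant `a · G · b`, the
  value of the program;
* `GKKP2011.rank_constPart_fromBlocks_abp` — its constant part has rank exactly `|V|` as soon as the
  value has no constant term (regularity, IL17 p0006:L22–L33);
* `hasRegularDetRepr_detPoly_cubic`: applied to the tree's Mahajan–Vinay / GKKP program for `det_n`
  (`GKKP2011.bigN`, `srcVec`, `snkVec`, `abpValue_eq_detPoly`; `2n³ + 2` internal vertices), `det_n` has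
  a REGULAR affine determinantal representation of size `2n³ + 3` over any field, `n ≥ 1`; hence
  `regularDetComplexity (detPoly (Fin n) k) ≤ 2n³ + 3` (`regularDetComplexity_detPoly_le_cubic`) —
  a kernel-checked POLYNOMIAL answer to LR17 Question 2.18. The printed constant `(m³ - m)/3 + 1` of
  IL17 Prop. 2.3 needs the leaner form of the Mahajan–Vinay program (IL17 Prop. 3.2) and remains the
  named fact `ikenmeyerLandsberg2017_prop_2_3`.

Honest framing: formalisation of published constructions; nothing here bears on lower bounds or on
VP versus VNP.
-/

noncomputable section

open MvPolynomial Matrix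

namespace Literature.Computability.AlgebraicComplexity

namespace GKKP2011

section ABPToRegular

variable {R : Type*} [CommRing R] {V : Type*} [Fintype V] [DecidableEq V]

/-- **IL17 Prop. 3.1, the matrix identity.** For a branching program with internal adjacency `N`,
`(1 + N) G = 1`, `det (1 + N) = 1`, source weights `a` and sink weights `b`, the matrix
`[[0, -aᵀ], [b, 1 + N]]` — adjacency matrix of the graph with source and sink identified (the root)
and loops at the other vertices, up to the harmless signs — has determinant the value `a · G · b` of the
program (Schur complement of the unipotent block). [cite: IkenmeyerLandsberg2017, Prop. 3.1] -/
theorem det_fromBlocks_abp (N G : Matrix V V R) (a b : V → R) (hG : (1 + N) * G = 1)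
    (hdet : (1 + N).det = 1) :
    (Matrix.fromBlocks (0 : Matrix (Fin 1) (Fin 1) R) (Matrix.replicateRow (Fin 1) (-a))
        (Matrix.replicateCol (Fin 1) b) (1 + N)).det = abpValue G a b := by
  letI : Invertible (1 + N) := invertibleOfRightInverse _ _ hG
  rw [Matrix.det_fromBlocks₂₂, hdet, one_mul, Matrix.det_unique]
  change ((0 : Matrix (Fin 1) (Fin 1) R) -
      Matrix.replicateRow (Fin 1) (-a) * G * Matrix.replicateCol (Fin 1) b) default default = _
  rw [Matrix.sub_apply, Matrix.zero_apply, ← Matrix.replicateRow_vecMul,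
    Matrix.replicateRow_mul_replicateCol_apply, Matrix.neg_vecMul, neg_dotProduct, zero_sub, neg_neg,
    ← Matrix.dotProduct_mulVec]
  rfl

variable {k : Type*} [Field k] {σ : Type*}

/-- **IL17 Prop. 3.1, regularity.** If moreover the entries are polynomials and the value has no
constant term, the constant part of `[[0, -aᵀ], [b, 1 + N]]` has rank exactly `|V|` (= size `- 1`): at
least `|V|` because its block `1 + N(0)` is unipotent, less than `|V| + 1` because its determinant is the
constant term of the value (IL17 p0006:L22–L33: "`Λ` is lower triangular with one exception … thus
`corank(Λ) = 1` or `0` … if `corank(Λ) = 0` then the constant term of `P` is `det Λ ≠ 0`").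
[cite: IkenmeyerLandsberg2017, Prop. 3.1] -/
theorem rank_constPart_fromBlocks_abp (N : Matrix V V (MvPolynomial σ k)) (a b : V → MvPolynomial σ k)
    (hdet : (1 + N).det = 1)
    (h0 : constantCoeff (Matrix.fromBlocks (0 : Matrix (Fin 1) (Fin 1) (MvPolynomial σ k))
      (Matrix.replicateRow (Fin 1) (-a)) (Matrix.replicateCol (Fin 1) b) (1 + N)).det = 0) :
    (constPart (Matrix.fromBlocks (0 : Matrix (Fin 1) (Fin 1) (MvPolynomial σ k))
      (Matrix.replicateRow (Fin 1) (-a)) (Matrix.replicateCol (Fin 1) b) (1 + N))).rank =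
      Fintype.card V := by
  set F := Matrix.fromBlocks (0 : Matrix (Fin 1) (Fin 1) (MvPolynomial σ k))
    (Matrix.replicateRow (Fin 1) (-a)) (Matrix.replicateCol (Fin 1) b) (1 + N) with hF
  -- upper bound: `det F(0) = (det F)(0) = 0`
  have hup : (constPart F).rank < Fintype.card (Fin 1 ⊕ V) := by
    refine Matrix.rank_lt_card_of_det_eq_zero ?_
    rw [det_constPart, h0]
  -- lower bound: the block `1 + N(0)` is a unit
  have hsub : (constPart F).submatrix Sum.inr Sum.inr = constPart (1 + N) := by
    funext u v
    simp only [Matrix.submatrix_apply, constPart_apply, hF, Matrix.fromBlocks_apply₂₂]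
  have hunit : IsUnit (constPart (1 + N)) := by
    rw [Matrix.isUnit_iff_isUnit_det, det_constPart, hdet, map_one]
    exact isUnit_one
  have hlow : Fintype.card V ≤ (constPart F).rank := by
    calc Fintype.card V = (constPart (1 + N)).rank := (Matrix.rank_of_isUnit _ hunit).symm
      _ = ((constPart F).submatrix Sum.inr Sum.inr).rank := by rw [hsub]
      _ ≤ (constPart F).rank := Matrix.rank_submatrix_le _ _ _
  rw [Fintype.card_sum, Fintype.card_fin] at hup
  omega

end ABPToRegular

section DetProgram

variable {k : Type*} [Field k] {n : ℕ}

/-- The admissible entries of the program (a variable or `0, 1, -1, 1/2`) are affine.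
[cite: GrenetEtAl2011, Thm 5] -/
theorem IsEntry.totalDegree_le_one {y : MvPolynomial (Fin n × Fin n) k} (h : IsEntry k n y) :
    y.totalDegree ≤ 1 := by
  rcases h with ⟨ij, rfl⟩ | rfl | rfl | rfl | rfl
  · exact (totalDegree_X _).le
  · simp
  · simp
  · rw [totalDegree_neg, totalDegree_one]; exact zero_le_one
  · rw [totalDegree_C]; exact zero_le_one

/-- `|Vtx n| + 1 = 2n³ + 3` (GKKP: "this graph has `2n³ + 3` vertices" with the sink; here with the
root of IL17's construction). [cite: GrenetEtAl2011, Thm 5 (proof)] -/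
theorem card_root_sum_vtx (n : ℕ) : Fintype.card (Fin 1 ⊕ Vtx n) = 2 * n ^ 3 + 3 := by
  simp only [Fintype.card_sum, Fintype.card_prod, Fintype.card_fin, Fintype.card_bool]
  ring

end DetProgram

end GKKP2011

open GKKP2011 in
/-- **`det_n` has a REGULAR affine determinantal representation of size `2n³ + 3`** (`n ≥ 1`, any
field): Ikenmeyer–Landsberg's Prop. 3.1 construction `[[0, -aᵀ], [b, 1 + N]]` on the tree's
Mahajan–Vinay / GKKP branching program for the determinant (`GKKP2011.bigN`, `2n³ + 2` internal
vertices, value `det_n` by `GKKP2011.abpValue_eq_detPoly`). A weak form (constant `2n³ + 3` instead of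
`(n³ - n)/3 + 1`) of IL17 Prop. 2.3. [cite: IkenmeyerLandsberg2017, Prop. 2.3 (weak form), Prop. 3.1] -/
theorem hasRegularDetRepr_detPoly_cubic (k : Type*) [Field k] {n : ℕ} (hn : 1 ≤ n) :
    HasRegularDetRepr (detPoly (Fin n) k) (2 * n ^ 3 + 3) := by
  classical
  have hn0 : n ≠ 0 := by omega
  obtain ⟨e⟩ : Nonempty (Fin 1 ⊕ Vtx n ≃ Fin (2 * n ^ 3 + 3)) :=
    ⟨Fintype.equivFinOfCardEq (card_root_sum_vtx n)⟩
  have hG := one_add_mul_geomInv (bigN_pow_eq_zero (k := k) (n := n))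
  have hdetF := det_fromBlocks_abp (bigN k n) (geomInv (bigN k n) (n + 1)) (srcVec k n) (snkVec k n)
    hG det_one_add_bigN
  rw [abpValue_eq_detPoly hn0] at hdetF
  refine ⟨Matrix.reindex e e (Matrix.fromBlocks (0 : Matrix (Fin 1) (Fin 1) (MvPolynomial (Fin n × Fin n) k))
      (Matrix.replicateRow (Fin 1) (-srcVec k n)) (Matrix.replicateCol (Fin 1) (snkVec k n))
      (1 + bigN k n)), ⟨fun i j => ?_, ?_⟩, ?_⟩
  · -- affine entries
    rw [Matrix.reindex_apply, Matrix.submatrix_apply]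
    rcases e.symm i with u | v <;> rcases e.symm j with u' | v'
    · rw [Matrix.fromBlocks_apply₁₁, Matrix.zero_apply, totalDegree_zero]; exact zero_le_one
    · rw [Matrix.fromBlocks_apply₁₂, Matrix.replicateRow_apply, Pi.neg_apply, totalDegree_neg]
      exact (isEntry_srcVec v').totalDegree_le_one
    · rw [Matrix.fromBlocks_apply₂₁, Matrix.replicateCol_apply]
      exact (isEntry_snkVec v).totalDegree_le_one
    · rw [Matrix.fromBlocks_apply₂₂, Matrix.add_apply, Matrix.one_apply]
      refine (totalDegree_add _ _).trans (max_le ?_ (isEntry_bigN v v').totalDegree_le_one)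
      split_ifs <;> simp
  · -- determinant
    rw [Matrix.det_reindex_self, hdetF]
  · -- regularity: `rank Λ = (2n³ + 3) - 1`
    have hrk := rank_constPart_fromBlocks_abp (bigN k n) (srcVec k n) (snkVec k n) det_one_add_bigN
      (by rw [hdetF, constantCoeff_detPoly k hn])
    have hcard : Fintype.card (Vtx n) = 2 * n ^ 3 + 2 := by
      have := card_root_sum_vtx n
      rw [Fintype.card_sum, Fintype.card_fin] at this
      omega
    rw [show constPart (Matrix.reindex e e _) = Matrix.reindex e e (constPart _) from rfl,
      Matrix.rank_reindex, hrk, hcard]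
    rfl

/-- Hence **`rdc(det_n) ≤ 2n³ + 3`** (`n ≥ 1`): the regular determinantal complexity of the determinant
grows at most cubically — a kernel-checked (weak-constant) form of IL17 Prop. 2.3, which answers LR17
Question 2.18 ("What is the growth of `rdc(det_m)`?") with "polynomial".
[cite: IkenmeyerLandsberg2017, Prop. 2.3 (weak form)] -/
theorem regularDetComplexity_detPoly_le_cubic (k : Type*) [Field k] {n : ℕ} (hn : 1 ≤ n) :
    regularDetComplexity (detPoly (Fin n) k) ≤ 2 * n ^ 3 + 3 :=
  regularDetComplexity_le (hasRegularDetRepr_detPoly_cubic k hn)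

end Literature.Computability.AlgebraicComplexity

end
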